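/-
COR-CM (cell pub-hodgecm2, stage 2 of the Hodge ladder) — count-neutral KERNEL COMBINATORICS «the index-two cyclic law» (modular ∪ semidihedral
columns), part V: THE ARC LATTICE — the unit squares of the torus `(ℤ/2n)²`, row telescoping, the descent to the half cross, and GENERATION BY
`β − 1` FACES for every twist `r` (seat prover-pub-hodgecm2-b23-g49-0, binder prover b23, gen 49; claim «INDEX-TWO CYCLIC LAW», HOME/INBOX.md
l.22678).  Theorems only, on parts I–IV (`Census/IndexTwoCyclic{Datum,ArcPairs,Descent,ArcHodge}.lean`), seat b23 gen 46ʼs tracked descent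
(`IndexTwoDescent.tracked_descent`, `IndexTwoDescent.span_translates_le_hodgeSpan`: `Census/IndexTwoSplitResidual.lean`, `Census/IndexTwoLifting.lean`)
and seat b09ʼs Hodge span (`Coinvariant.hodgeSpan`, `exists_forall_typeSum_eq_of_mem_hodgeSpan`: `Census/CoinvariantFibre.lean`), all BY NAME;
no `decide`, no certificate, no named fact, no `sorry`; `Interfaces.lean` (C1), every E term, B01, `Transposition/*`, `PortJoin/*`, `D2Bridge/*` untouched.
HONEST FRAMING: `HC_CM` is NOT proved, here or anywhere in the tree; nothing here is a period, a count of record or a headline.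
T5: n/a-class (hypothesis binders = the fields of `IndexTwoCyclic.Datum` and `c·c = 1`; checker: self).
-/
import Summits.HodgeConjecture.CorCM.Census.IndexTwoCyclicArcHodge
import Summits.HodgeConjecture.CorCM.Census.IndexTwoCyclicDescent
import Summits.HodgeConjecture.CorCM.Census.IndexTwoSplitResidual

/-!
# The index-two cyclic law, V: the arc lattice — `β − 1` faces generate, for every twist `r`

THE SETTING of parts I–IV: an index-two cyclic datum `D` for `(G, c)` (`G ≅ ℤ/2n ⋊_r ℤ/2`, `c = uⁿ`, involution `w`, `w·u = uʳ·w`), the arc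
pairs `A(a,b)`, `(a,b) ∈ (ℤ/2n)²`, and the ARC FACES `F(a,b) = [A(a,b)] + [A(a−1,b−1)] − [A(a−1,b)] − [A(a,b−1)]` — the unit squares of the torus
`(ℤ/2n)²` (part II, `gface_biArc`).  The base changes of `F(a,b)` are exactly the `F(a',b')` along the block of `A(a,b)`, i.e. with
`b' − ra' ∈ {e, −re}`, `e = b − ra`.

* §1 ROW TELESCOPING: `Σ_b F(a, b) = 0` (`sum_gface_biArc_row`), so the squares of the diagonal class `b = ra` (the block of `A(0,0)`, a single
  square per row) lie in the span of the others (`gface_biArc_mem_of_offDiag`).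
* §2 THE DESCENT TO THE HALF CROSS (`exists_descent_cross`): modulo the pairs and all unit squares, every vector supported on arc pairs is congruent
  to one supported on `R = {A(a,0) ∣ a.val ≤ n} ∪ {A(0,b) ∣ b.val ≤ n}` — gen 46ʼs tracked descent along the potential
  `2(a.val + b.val) + [far half axis]`: the square lowers `a` or `b` off the axes, the pair `[A(a,0)] + [A(a−n,n)]` folds the far half of an axis.
* §3 **GENERATION (`exists_gfaces_generate`).**  There is a family `S` of face relations with **`|S| + 1 ≤ β(G, c)`** whose base changes together
  with the pairs generate the integer Hodge lattice — INTEGRALLY, for EVERY twist `r`: `S₁` = one coordinate face per block without arc pairs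
  (part III), `S₂` = one arc face per arc-pair block other than the block of `A(0,0)`; a Hodge vector descends to the arc pairs (part III), then to
  the half cross (§2), where it is a multiple of a pair (part IV).
Part VI: under the odd-coset hypothesis (modular, semidihedral, …) the floor `β − 1 ≤ |S|` holds, so `μ(G, c) = β − 1 = φ₂`.

## References
* [Pohlmann1968] H. Pohlmann, Algebraic cycles on abelian varieties of complex multiplication type, Ann. of Math. 88 (1968), Thm 1.
* [Milne1999] J. S. Milne, Lefschetz motives and the Tate conjecture, Compositio Math. 117 (1999), Prop. 2.1, p. 54.
-/

namespace Summit.HodgeConjecture.CorCM.Census.IndexTwoCyclic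

open Finset
open Summit.HodgeConjecture.CorCM.Prior.AllgGroup.RfwfAllgGroup
open Summit.HodgeConjecture.CorCM.Census.BlockParity
open Summit.HodgeConjecture.CorCM.Census.Coinvariant
open Summit.HodgeConjecture.CorCM.Census.Dihedral (val_add_n)
open Summit.HodgeConjecture.CorCM.Census.TwistGeneration (val_n)

noncomputable section

variable {G : Type*} [Group G] [Fintype G] [DecidableEq G] {c : G} {n : ℕ} [NeZero n]
variable (D : Datum G c n)

/-! ## §1 Row telescoping -/

/-- **ROW TELESCOPING**: the arc faces of one row of the torus sum to zero, `Σ_b F(a, b) = 0`. [folklore] -/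
theorem sum_gface_biArc_row (hc2 : c * c = 1) (a : ZMod (2 * n)) :
    ∑ b : ZMod (2 * n), gface c hc2 (biArc D a b) (D.u ^ a.val) (D.u ^ b.val * D.w) = 0 := by
  simp only [gface_biArc]
  rw [Finset.sum_sub_distrib, Finset.sum_sub_distrib, Finset.sum_add_distrib]
  have h1 : ∑ b : ZMod (2 * n), Finsupp.single (biArc D (a - 1) (b - 1)) (1 : ℤ) = ∑ b : ZMod (2 * n), Finsupp.single (biArc D (a - 1) b) 1 :=
    Fintype.sum_equiv (Equiv.subRight 1) _ _ (fun b => rfl)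
  have h2 : ∑ b : ZMod (2 * n), Finsupp.single (biArc D a (b - 1)) (1 : ℤ) = ∑ b : ZMod (2 * n), Finsupp.single (biArc D a b) 1 :=
    Fintype.sum_equiv (Equiv.subRight 1) _ _ (fun b => rfl)
  rw [h1, h2]
  abel

omit [Fintype G] [DecidableEq G] [NeZero n] in
/-- Off the diagonal class stays off: if `b − ra = 0` and `b' ≠ b` then `b' − ra ≠ 0`. [folklore] -/
theorem sub_ne_zero_of_ne {a b b' : ZMod (2 * n)} (h : b - (D.r : ZMod (2 * n)) * a = 0) (hb : b' ≠ b) :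
    b' - (D.r : ZMod (2 * n)) * a ≠ 0 := fun h' => hb (by rw [sub_eq_zero] at h h'; rw [h, h'])

/-- **All unit squares from the off-diagonal ones**: if a submodule contains every arc face `F(a,b)` with `b − ra ≠ 0`, it contains every arc face
(the diagonal square of a row is minus the sum of the others). [folklore] -/
theorem gface_biArc_mem_of_offDiag (hc2 : c * c = 1) (N : Submodule ℤ (CMF G c →₀ ℤ))
    (hF : ∀ a b : ZMod (2 * n), b - (D.r : ZMod (2 * n)) * a ≠ 0 → gface c hc2 (biArc D a b) (D.u ^ a.val) (D.u ^ b.val * D.w) ∈ N)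
    (a b : ZMod (2 * n)) : gface c hc2 (biArc D a b) (D.u ^ a.val) (D.u ^ b.val * D.w) ∈ N := by
  classical
  by_cases h : b - (D.r : ZMod (2 * n)) * a = 0
  · have hsum := sum_gface_biArc_row D hc2 a
    rw [← Finset.add_sum_erase _ _ (mem_univ b)] at hsum
    rw [eq_neg_of_add_eq_zero_left hsum]
    refine Submodule.neg_mem _ (Submodule.sum_mem _ fun b' hb' => hF a b' ?_)
    exact sub_ne_zero_of_ne D h (Finset.mem_erase.mp hb').1
  · exact hF a b h

/-! ## §2 The descent to the half cross -/

/-- **THE DESCENT TO THE HALF CROSS.**  If `N` contains the pairs and all arc faces, every vector supported on arc pairs is congruent modulo `N`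
to one supported on `{A(a,0) ∣ a.val ≤ n} ∪ {A(0,b) ∣ b.val ≤ n}`. [folklore] -/
theorem exists_descent_cross (hc2 : c * c = 1) (N : Submodule ℤ (CMF G c →₀ ℤ)) (hP : ∀ Ψ : CMF G c, pair c Ψ ∈ N)
    (hF : ∀ a b : ZMod (2 * n), gface c hc2 (biArc D a b) (D.u ^ a.val) (D.u ^ b.val * D.w) ∈ N)
    (y : CMF G c →₀ ℤ) (hy : ∀ Ψ ∈ y.support, ∃ a b : ZMod (2 * n), Ψ = biArc D a b) :
    ∃ y' : CMF G c →₀ ℤ, y - y' ∈ N ∧ ∀ Ψ ∈ y'.support, ∃ a : ZMod (2 * n), a.val ≤ n ∧ (Ψ = biArc D a 0 ∨ Ψ = biArc D 0 a) := by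
  classical
  have hn : 1 ≤ n := Nat.one_le_iff_ne_zero.mpr (NeZero.ne n)
  set Nn : ZMod (2 * n) := (n : ZMod (2 * n)) with hNn
  have hNval : Nn.val = n := val_n
  have hN0 : Nn ≠ 0 := fun h => by
    have h2 := congrArg ZMod.val h
    rw [hNval, ZMod.val_zero] at h2
    exact NeZero.ne n h2
  -- the potential
  set P : CMF G c → ℕ := fun Ψ => if h : ∃ ab : ZMod (2 * n) × ZMod (2 * n), Ψ = biArc D ab.1 ab.2 then
      2 * (h.choose.1.val + h.choose.2.val) + (if (h.choose.2 = 0 ∧ n < h.choose.1.val) ∨ (h.choose.1 = 0 ∧ n < h.choose.2.val) then 1 else 0)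
    else 0 with hPdef
  have hPval : ∀ a b : ZMod (2 * n),
      P (biArc D a b) = 2 * (a.val + b.val) + (if (b = 0 ∧ n < a.val) ∨ (a = 0 ∧ n < b.val) then 1 else 0) := by
    intro a b
    have h : ∃ ab : ZMod (2 * n) × ZMod (2 * n), biArc D a b = biArc D ab.1 ab.2 := ⟨(a, b), rfl⟩
    have e : P (biArc D a b) = 2 * (h.choose.1.val + h.choose.2.val) +
        (if (h.choose.2 = 0 ∧ n < h.choose.1.val) ∨ (h.choose.1 = 0 ∧ n < h.choose.2.val) then 1 else 0) := by
      rw [hPdef]; exact dif_pos h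
    obtain ⟨e1, e2⟩ := biArc_injective D h.choose_spec
    rw [e, ← e1, ← e2]
  have hPle : ∀ a b : ZMod (2 * n), P (biArc D a b) ≤ 2 * (a.val + b.val) + 1 := by
    intro a b; rw [hPval]; split_ifs <;> omega
  have hstep : ∀ Ψ : CMF G c, (∃ a b : ZMod (2 * n), Ψ = biArc D a b) →
      ¬ (∃ a : ZMod (2 * n), a.val ≤ n ∧ (Ψ = biArc D a 0 ∨ Ψ = biArc D 0 a)) →
      ∃ v ∈ N, ∃ w : CMF G c →₀ ℤ, (∀ Φ : CMF G c, w Φ ≠ 0 → (∃ a b : ZMod (2 * n), Φ = biArc D a b) ∧ P Φ < P Ψ) ∧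
        v = Finsupp.single Ψ 1 + w := by
    rintro Ψ ⟨a, b, rfl⟩ hres
    by_cases hb : b = 0
    · -- the far half of the `a`-axis: fold with the pair `[A(a,0)] + [A(a−n, n)]`
      subst hb
      have ha : n < a.val := by
        by_contra hle
        exact hres ⟨a, not_lt.mp hle, Or.inl rfl⟩
      have hval : (a - Nn).val = a.val - n := by rw [ZMod.val_sub (by rw [hNval]; omega), hNval]
      refine ⟨pair c (biArc D (a - Nn) Nn), hP _, Finsupp.single (biArc D (a - Nn) Nn) 1, fun Φ hΦ => ?_, ?_⟩
      · rw [Finsupp.single_apply] at hΦ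
        split_ifs at hΦ with h
        · refine ⟨⟨a - Nn, Nn, h.symm⟩, ?_⟩
          have hc1 : ¬ ((Nn = 0 ∧ n < a.val - n) ∨ (a - Nn = 0 ∧ n < n)) := by
            rintro (⟨h1, -⟩ | ⟨-, h2⟩)
            · exact hN0 h1
            · exact lt_irrefl n h2
          rw [← h, hPval, hPval, hval, hNval, ZMod.val_zero, if_neg hc1, if_pos (Or.inl ⟨rfl, ha⟩)]
          omega
        · exact absurd rfl hΦ
      · rw [pair, rt_c_biArc, sub_add_cancel, QuaternionColumn.two_n_eq_zero, add_comm]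
    · by_cases ha : a = 0
      · -- the far half of the `b`-axis: fold with the pair `[A(0,b)] + [A(n, b−n)]`
        subst ha
        have hbv : n < b.val := by
          by_contra hle
          exact hres ⟨b, not_lt.mp hle, Or.inr rfl⟩
        have hval : (b - Nn).val = b.val - n := by rw [ZMod.val_sub (by rw [hNval]; omega), hNval]
        refine ⟨pair c (biArc D Nn (b - Nn)), hP _, Finsupp.single (biArc D Nn (b - Nn)) 1, fun Φ hΦ => ?_, ?_⟩
        · rw [Finsupp.single_apply] at hΦ
          split_ifs at hΦ with h
          · refine ⟨⟨Nn, b - Nn, h.symm⟩, ?_⟩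
            have hc1 : ¬ ((b - Nn = 0 ∧ n < n) ∨ (Nn = 0 ∧ n < b.val - n)) := by
              rintro (⟨-, h1⟩ | ⟨h2, -⟩)
              · exact lt_irrefl n h1
              · exact hN0 h2
            rw [← h, hPval, hPval, hval, hNval, ZMod.val_zero, if_neg hc1, if_pos (Or.inr ⟨rfl, hbv⟩)]
            omega
          · exact absurd rfl hΦ
        · rw [pair, rt_c_biArc, sub_add_cancel, QuaternionColumn.two_n_eq_zero, add_comm]
      · -- the interior: the unit square lowers `a` or `b`
        have hav : (a - 1).val = a.val - 1 := QuaternionColumn.val_sub_one_of_ne ha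
        have hbv : (b - 1).val = b.val - 1 := QuaternionColumn.val_sub_one_of_ne hb
        have ha1 : 1 ≤ a.val := Nat.one_le_iff_ne_zero.mpr fun h => ha ((ZMod.val_eq_zero a).mp h)
        have hb1 : 1 ≤ b.val := Nat.one_le_iff_ne_zero.mpr fun h => hb ((ZMod.val_eq_zero b).mp h)
        have hPΨ : P (biArc D a b) = 2 * (a.val + b.val) := by
          rw [hPval, if_neg]
          · rfl
          · rintro (⟨h1, -⟩ | ⟨h2, -⟩)
            · exact hb h1
            · exact ha h2
        refine ⟨gface c hc2 (biArc D a b) (D.u ^ a.val) (D.u ^ b.val * D.w), hF a b,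
          Finsupp.single (biArc D (a - 1) (b - 1)) 1 - Finsupp.single (biArc D (a - 1) b) 1 - Finsupp.single (biArc D a (b - 1)) 1,
          fun Φ hΦ => ?_, by rw [gface_biArc]; abel⟩
        have hΦ3 : Φ = biArc D (a - 1) (b - 1) ∨ Φ = biArc D (a - 1) b ∨ Φ = biArc D a (b - 1) := by
          by_contra hne
          push Not at hne
          apply hΦ
          rw [Finsupp.sub_apply, Finsupp.sub_apply, Finsupp.single_apply, Finsupp.single_apply, Finsupp.single_apply,
            if_neg (fun h => hne.1 h.symm), if_neg (fun h => hne.2.1 h.symm), if_neg (fun h => hne.2.2 h.symm), sub_zero, sub_zero]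
        rw [hPΨ]
        rcases hΦ3 with rfl | rfl | rfl
        · exact ⟨⟨a - 1, b - 1, rfl⟩, by have := hPle (a - 1) (b - 1); rw [hav, hbv] at this; omega⟩
        · exact ⟨⟨a - 1, b, rfl⟩, by have := hPle (a - 1) b; rw [hav] at this; omega⟩
        · exact ⟨⟨a, b - 1, rfl⟩, by have := hPle a (b - 1); rw [hbv] at this; omega⟩
  obtain ⟨y', h1, -, h3⟩ := IndexTwoDescent.tracked_descent P
    (fun Ψ => ∃ a : ZMod (2 * n), a.val ≤ n ∧ (Ψ = biArc D a 0 ∨ Ψ = biArc D 0 a))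
    (fun Ψ => ∃ a b : ZMod (2 * n), Ψ = biArc D a b) N hstep y hy
  exact ⟨y', h1, h3⟩

/-! ## §3 Generation by `β − 1` faces -/

/-- The block of `A(0,0)` contains an arc pair as its representative (every block of an arc pair does). [folklore] -/
theorem exists_out_eq_biArc (a b : ZMod (2 * n)) : ∃ a' b' : ZMod (2 * n), (blk c (biArc D a b)).out = biArc D a' b' := by
  obtain ⟨Q, hQ⟩ := exists_rt_eq_of_blk_eq c
    (show blk c (biArc D a b) = blk c (blk c (biArc D a b)).out from (Quotient.out_eq _).symm)
  rw [← hQ]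
  exact (exists_biArc_rt_iff D Q _).mpr ⟨a, b, rfl⟩

omit [DecidableEq G] in
include D in
/-- `c` is central along the datum (from `comm_pow_n`; kept file-local — the statement coincides with other laneʼs). [folklore] -/
private theorem mul_c_comm (y : G) : y * c = c * y := by
  have h := D.comm_pow_n y
  rwa [D.hun] at h

include D in
/-- **GENERATION BY `β − 1` FACES, FOR EVERY TWIST `r`.**  There is a family `S` of face relations with `|S| + 1 ≤ β(G, c)` whose base changes,
together with the pairs, generate the integer Hodge lattice of the index-two cyclic datum — integrally. [folklore] -/
theorem exists_gfaces_generate (hc2 : c * c = 1) :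
    ∃ S : Finset (CMF G c →₀ ℤ), (↑S ⊆ gfaceSet G c hc2) ∧ S.card + 1 ≤ Fintype.card (Block c) ∧
      hodgeSpan c hc2 ≤ Submodule.span ℤ (pairSet c) ⊔ Submodule.span ℤ (translates c S) := by
  classical
  obtain ⟨S₁, hS₁F, hS₁card, hS₁⟩ := exists_faces_descent_to_biArcs D hc2
  -- representative parameters of the arc-pair blocks
  have hrep : ∀ B : Block c, ∃ ab : ZMod (2 * n) × ZMod (2 * n), (∃ a b : ZMod (2 * n), B.out = biArc D a b) → B.out = biArc D ab.1 ab.2 := by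
    intro B
    by_cases h : ∃ a b : ZMod (2 * n), B.out = biArc D a b
    · obtain ⟨a, b, h⟩ := h
      exact ⟨(a, b), fun _ => h⟩
    · exact ⟨(0, 0), fun h' => absurd h' h⟩
  choose ab hab using hrep
  set arcB : Finset (Block c) := univ.filter fun B : Block c => ∃ a b : ZMod (2 * n), B.out = biArc D a b with harcB
  set B₀ : Block c := blk c (biArc D 0 0) with hB₀
  set face : Block c → (CMF G c →₀ ℤ) := fun B =>
    gface c hc2 (biArc D (ab B).1 (ab B).2) (D.u ^ (ab B).1.val) (D.u ^ (ab B).2.val * D.w) with hface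
  set S₂ : Finset (CMF G c →₀ ℤ) := (arcB.erase B₀).image face with hS₂
  have hmemArc : ∀ a b : ZMod (2 * n), blk c (biArc D a b) ∈ arcB := fun a b =>
    mem_filter.mpr ⟨mem_univ _, exists_out_eq_biArc D a b⟩
  have hS₂F : (↑S₂ : Set (CMF G c →₀ ℤ)) ⊆ gfaceSet G c hc2 := by
    intro f hf
    obtain ⟨B, -, rfl⟩ := Finset.mem_image.mp (Finset.mem_coe.mp hf)
    exact gface_biArc_mem_gfaceSet D hc2 _ _
  have hF : (↑(S₁ ∪ S₂) : Set (CMF G c →₀ ℤ)) ⊆ gfaceSet G c hc2 := by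
    rw [Finset.coe_union]; exact Set.union_subset hS₁F hS₂F
  refine ⟨S₁ ∪ S₂, hF, ?_, fun y hy => ?_⟩
  · -- the count: `|S₁| ≤ #{blocks without arc pairs}`, `|S₂| ≤ #{arc-pair blocks} − 1`
    have h2 : S₂.card ≤ arcB.card - 1 := by
      have h := Finset.card_image_le (s := arcB.erase B₀) (f := face)
      rw [Finset.card_erase_of_mem (hmemArc 0 0)] at h
      exact h
    have h3 : 1 ≤ arcB.card := Finset.card_pos.mpr ⟨B₀, hmemArc 0 0⟩
    have htot := Finset.card_filter_add_card_filter_not (s := (univ : Finset (Block c)))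
      (p := fun B : Block c => ∃ a b : ZMod (2 * n), B.out = biArc D a b)
    rw [Finset.card_univ, ← harcB] at htot
    have hu := Finset.card_union_le S₁ S₂
    omega
  · -- generation
    set N := Submodule.span ℤ (pairSet c) ⊔ Submodule.span ℤ (translates c (S₁ ∪ S₂)) with hN
    have hsub : ∀ T : Finset (CMF G c →₀ ℤ), T ⊆ S₁ ∪ S₂ → translates c T ⊆ translates c (S₁ ∪ S₂) := by
      rintro T hT _ ⟨Q, f, hf, rfl⟩
      exact ⟨Q, f, hT hf, rfl⟩
    have hPairs : ∀ Ψ : CMF G c, pair c Ψ ∈ N := fun Ψ =>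
      Submodule.mem_sup_left (Submodule.subset_span (pair_mem_pairSet c Ψ))
    -- the off-diagonal arc faces are base changes of members of `S₂`
    have hFoff : ∀ a b : ZMod (2 * n), b - (D.r : ZMod (2 * n)) * a ≠ 0 →
        gface c hc2 (biArc D a b) (D.u ^ a.val) (D.u ^ b.val * D.w) ∈ N := by
      intro a b hab0
      set B := blk c (biArc D a b) with hBdef
      have hBarc : ∃ a' b' : ZMod (2 * n), B.out = biArc D a' b' := exists_out_eq_biArc D a b
      have hBne : B ≠ B₀ := blk_biArc_ne_of_sub_ne_zero D hab0
      have hBmem : B ∈ arcB.erase B₀ := Finset.mem_erase.mpr ⟨hBne, hmemArc a b⟩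
      have hfaceS : face B ∈ S₁ ∪ S₂ := Finset.mem_union_right _ (Finset.mem_image.mpr ⟨B, hBmem, rfl⟩)
      have hout := hab B hBarc
      obtain ⟨Q, hQ⟩ := exists_rt_eq_of_blk_eq c
        (show blk c (biArc D (ab B).1 (ab B).2) = blk c (biArc D a b) by rw [← hout]; exact Quotient.out_eq _)
      obtain ⟨a', b', hrt, hmap⟩ := mapDomain_rt_gface_biArc D hc2 (ab B).1 (ab B).2 Q
      rw [hQ] at hrt
      obtain ⟨e1, e2⟩ := biArc_injective D hrt
      rw [← e1, ← e2] at hmap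
      rw [← hmap]
      exact Submodule.mem_sup_right (Submodule.subset_span ⟨Q, face B, hfaceS, rfl⟩)
    have hFall : ∀ a b : ZMod (2 * n), gface c hc2 (biArc D a b) (D.u ^ a.val) (D.u ^ b.val * D.w) ∈ N :=
      gface_biArc_mem_of_offDiag D hc2 N hFoff
    -- descend `y`: to the arc pairs, then to the half cross, where it is a pair
    obtain ⟨y₁, h₁, hy₁⟩ := hS₁ y
    have h₁' : y - y₁ ∈ N := Submodule.mem_sup_right (Submodule.span_mono (hsub S₁ Finset.subset_union_left) h₁)
    obtain ⟨y₂, h₂, hy₂⟩ := exists_descent_cross D hc2 N hPairs hFall y₁ hy₁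
    have hNH : N ≤ hodgeSpan c hc2 :=
      sup_le le_sup_right (IndexTwoDescent.span_translates_le_hodgeSpan hc2 _ hF)
    have hy₂H : y₂ ∈ hodgeSpan c hc2 := by
      have e : y₂ = y - ((y - y₁) + (y₁ - y₂)) := by abel
      rw [e]
      exact Submodule.sub_mem _ hy (hNH (Submodule.add_mem _ h₁' h₂))
    have hy₂P : y₂ ∈ Submodule.span ℤ (pairSet c) :=
      mem_span_pairSet_of_cross D hc2 y₂ hy₂ (exists_forall_typeSum_eq_of_mem_hodgeSpan c hc2 (mul_c_comm D) hy₂H)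
    have e : y = ((y - y₁) + (y₁ - y₂)) + y₂ := by abel
    rw [e]
    exact Submodule.add_mem _ (Submodule.add_mem _ h₁' h₂) (Submodule.mem_sup_left hy₂P)

end

end Summit.HodgeConjecture.CorCM.Census.IndexTwoCyclic
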